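import Summits.QuantumFields.BalabanUV.Gaps.EndDrawdownLinearRoad

/-!
# Gaps / EndDrawdownModulusRoad — FORCING IS MODULUS-FREE: over the remainder class `|β¹_{k+1}(g_0,…,g_k)| ≤ ω(g_k)` on `]0,γ₀]` for ANY modulus
# `ω` (continuous, monotone, positive on `]0,∞[`, `ω(0+) = 0` — the linear `C·g` of (2.14), Hölder moduli, `1∕log(1∕g)`, …; every such class lies
# inside the every-slope class), the END statement is FORCED **iff** `∃ r > 0, DwSeq β⁰ r` — the SAME threshold as on the every-slope road and on the
# linear road, for every real one-loop sequence.  ⟸ is the every-slope sufficiency restricted to the subclass; ⟹ runs the modulus adversary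
# `b_k − ω(g_k)`: along a run of any forward-generated construction in a box ending at `g⋆`, the forward-generated one-sided steps and `DwSeq b 0` (which
# forcing implies through the zero remainder) give the COUNTING INEQUALITY `(n − k)·ω(1∕T) ≤ T²`, `T² = 1∕g⋆² + M₀ + Σ_{[k,n)} b` (penalty `≥ ω(1∕T)` at
# every step since every coupling is `≥ 1∕T`), whence windows of a fixed length carry mass `≥ 1` and `DwSeq b (1∕m₀)` — `EndDrawdownLinearRoad`'s
# 3∕2-power law is the case `ω(x) = C·x`.  So NO remainder modulus whatsoever lowers the END-grade forcing threshold below the drawdown slope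
# (this seat's own leaf; cell pub-balaban-gaps, seat g1-p3 GEN 9, rows CAP ∕ tail ∕ (D4) «split ∕ weakening»; file 15 of «the one-loop interface of
# the END statement»)

HONEST FRAMING (cell rule, page 1 of everything): [folklore] window arithmetic along in-interval runs of forward-generated constructions for a TOY
family on the tree's carrier; `EndForcedMod` is a quantified READING of the cell's END-grade statement over Bałaban-free data `(b, ω, γ₀)`, not a
binder; the modulus classes are hypothesis SHAPES of row (D4)'s remainder (none of them printed for Bałaban's split with constants uniform in the
scale); nothing of Bałaban's table is certified (NODE-O 0∕1); words ∕ odds UNCHANGED.  Nothing of Bałaban's is asserted; 0∕6 binders; one finite T⁴;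
NOT [I] Thm 2, NOT `BetaPertH`, NOT the continuum limit, NOT Clay.

CITATION HEADER (tags CONTEXT ONLY).  [I] = T. Bałaban, Commun. Math. Phys. **109** (1987) 249–301 [Balaban1987RG1]: (0.20) p. 256, Thm 2
p. 259 (first sentence), Thm 3 p. 264, (2.12)–(2.14) p. 268.
-/

namespace Summit.QuantumFields.BalabanUV.Gaps.EndDrawdownModulusRoad

open Literature.MathematicalPhysics.QuantumFieldTheory.Balaban1983to89
open Literature.MathematicalPhysics.QuantumFieldTheory.Balaban1983to89.FlowStep
open Literature.MathematicalPhysics.QuantumFieldTheory.Balaban1983to89.FlowStepRuns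
open Literature.MathematicalPhysics.QuantumFieldTheory.Balaban1983to89.DagBinding
open Literature.MathematicalPhysics.QuantumFieldTheory.Balaban1983to89.Beta.RemainderChain (RemainderConst)
open Summit.QuantumFields.BalabanUV.Gaps.CapSignsConstRoad (EverySlope)
open Summit.QuantumFields.BalabanUV.Gaps.CapSignsNecessaryFwd (windowSum_ge_of_forwardGenerated)
open Summit.QuantumFields.BalabanUV.Gaps.EndDrawdownSeq
open Summit.QuantumFields.BalabanUV.Gaps.EndDrawdownBand
open Summit.QuantumFields.BalabanUV.Gaps.EndDrawdownEverySlope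
open Summit.QuantumFields.BalabanUV.Gaps.EndDrawdownEverySlopeDecided
open Finset

noncomputable section

variable {b : ℕ → ℝ}

/-! ## §1 Moduli, the modulus class, and its place inside the every-slope class -/

/-- A REMAINDER MODULUS: continuous on `]0,∞[`, monotone, positive on `]0,∞[`, and `ω(x) → 0` as `x → 0⁺` (stated as: below every `s > 0` near `0`).
[folklore] -/
structure IsModulus (ω : ℝ → ℝ) : Prop where
  cont : ContinuousOn ω (Set.Ioi 0)
  mono : ∀ x y, 0 < x → x ≤ y → ω x ≤ ω y
  pos : ∀ x, 0 < x → 0 < ω x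
  small : ∀ s, 0 < s → ∃ γ, 0 < γ ∧ ω γ ≤ s

/-- The linear modulus `C·x` (`C > 0`) is a modulus. [folklore] -/
theorem isModulus_linear {C : ℝ} (hC : 0 < C) : IsModulus (fun x => C * x) :=
  ⟨(continuous_const.mul continuous_id).continuousOn, fun _ _ _ hxy => mul_le_mul_of_nonneg_left hxy hC.le, fun _ hx => mul_pos hC hx,
    fun s hs => ⟨s / C, by positivity, by rw [mul_div_cancel₀ _ hC.ne']⟩⟩

/-- QUANTIFIED READING (universal) over the MODULUS class · E for EVERY realization of `b` whose remainder satisfies `|β¹_{k+1}(p)| ≤ ω(p_k)` on the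
`]0,γ₀]`-histories, (C) on `]0,γ₀]`, any forward-generated construction. [cite: Balaban1987RG1, Thm 2 p.259 (first sentence) and (2.12)–(2.14) p.268] -/
def EndForcedMod (b : ℕ → ℝ) (ω : ℝ → ℝ) (γ₀ : ℝ) : Prop :=
  ∀ (β : HBeta) (Sβ : B12Beta.OneLoopSplit β) (Cn : B12.Construction), (∀ j, Sβ.β0 j = b j) →
    (∀ (k : ℕ) (p : Fin (k + 1) → ℝ), p ∈ B12Beta.HistBox γ₀ k → |Sβ.β1 k p| ≤ ω (p (Fin.last k))) →
      BetaContH γ₀ β → ForwardGenerated Cn β → EndpointExistence Cn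

/-- A modulus class lies inside the every-slope class: `|β¹| ≤ ω(g_k)` on `]0,γ₀]` ⟹ `EverySlope Sβ γ₀` (`0 < γ₀`; on the box `]0, min γ₀ γ_s]` the
remainder is `≤ ω(γ_s) ≤ s`). [cite: Balaban1987RG1, Thm 3 p.264] -/
theorem everySlope_of_modulus {β : HBeta} (Sβ : B12Beta.OneLoopSplit β) {ω : ℝ → ℝ} (hω : IsModulus ω) {γ₀ : ℝ} (hγ₀ : 0 < γ₀)
    (hM : ∀ (k : ℕ) (p : Fin (k + 1) → ℝ), p ∈ B12Beta.HistBox γ₀ k → |Sβ.β1 k p| ≤ ω (p (Fin.last k))) : EverySlope Sβ γ₀ := by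
  intro s hs
  obtain ⟨γ, hγ, hγs⟩ := hω.small s hs
  refine ⟨min γ₀ γ, lt_min hγ₀ hγ, min_le_left _ _, fun k p hp => ?_⟩
  have hlast := hp (Fin.last k)
  have h1 := hM k p fun i => ⟨(hp i).1, (hp i).2.trans (min_le_left _ _)⟩
  exact h1.trans ((hω.mono _ _ hlast.1 (hlast.2.trans (min_le_right _ _))).trans hγs)

/-- FORCED_ES ⟹ FORCED over every modulus class (`0 < γ₀`). [cite: Balaban1987RG1, Thm 3 p.264 and (2.12)–(2.14) p.268] -/
theorem endForcedMod_of_endForcedES {ω : ℝ → ℝ} (hω : IsModulus ω) {γ₀ : ℝ} (hγ₀ : 0 < γ₀) (h : EndForcedES b γ₀) : EndForcedMod b ω γ₀ :=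
  fun _ Sβ _ hb hM hcont hgen => h _ Sβ _ hb (everySlope_of_modulus Sβ hω hγ₀ hM) hcont hgen

/-! ## §2 The modulus adversary `b_k − ω(g_k)` and the counting inequality -/

/-- THE MODULUS ADVERSARY · one-loop part `b`, remainder `−ω(g_k)` on histories with positive last coupling. A TOY. [folklore] -/
def betaMod (b : ℕ → ℝ) (ω : ℝ → ℝ) : HBeta := fun k p => b k + (if 0 < p (Fin.last k) then -ω (p (Fin.last k)) else 0)

/-- Its printed split. [folklore] -/
def splitMod (b : ℕ → ℝ) (ω : ℝ → ℝ) : B12Beta.OneLoopSplit (betaMod b ω) where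
  β0 := b
  β1 := fun k p => if 0 < p (Fin.last k) then -ω (p (Fin.last k)) else 0
  split := fun _ _ => rfl
  vanish := fun k p hp => by simp [hp]

/-- On a history with positive last coupling: `β_{k+1} = b_k − ω(g_k)`. [folklore] -/
theorem betaMod_of_pos (b : ℕ → ℝ) (ω : ℝ → ℝ) (k : ℕ) {p : Fin (k + 1) → ℝ} (hp : 0 < p (Fin.last k)) :
    betaMod b ω k p = b k - ω (p (Fin.last k)) := by
  simp [betaMod, hp]; ring

/-- (C) for the modulus adversary on every box (ω continuous on `]0,∞[`). [folklore] -/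
theorem betaContH_betaMod (b : ℕ → ℝ) {ω : ℝ → ℝ} (hω : IsModulus ω) (γ : ℝ) : BetaContH γ (betaMod b ω) := fun k =>
  (continuousOn_const.sub (hω.cont.comp (continuous_apply (Fin.last k)).continuousOn
    fun _ hp => ((mem_box.mp hp) (Fin.last k)).1)).congr fun _ hp => betaMod_of_pos b ω k ((mem_box.mp hp) (Fin.last k)).1

/-- The modulus adversary is in the modulus class on every box. [folklore] -/
theorem mod_splitMod (b : ℕ → ℝ) {ω : ℝ → ℝ} (hω : IsModulus ω) (γ : ℝ) (k : ℕ) (p : Fin (k + 1) → ℝ) (hp : p ∈ B12Beta.HistBox γ k) :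
    |(splitMod b ω).β1 k p| ≤ ω (p (Fin.last k)) := by
  have hlast := (hp (Fin.last k)).1
  show |(if 0 < p (Fin.last k) then -ω (p (Fin.last k)) else 0)| ≤ ω (p (Fin.last k))
  rw [if_pos hlast, abs_neg, abs_of_pos (hω.pos _ hlast)]

/-- **THE COUNTING INEQUALITY** · `b` with bounded drawdown below the `0`-line (bound `M₀`), a modulus `ω`, a run of ANY forward-generated construction
of `b − ω(g_k)` in a box up to `n` ending at `g_n = g⋆`: for every `k ≤ n`, with `T := √(1∕g⋆² + M₀ + Σ_{[k,n)} b)`,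
`(n − k)·ω(1∕T) ≤ T²` — backward `1∕g_j² ≤ T²` (so `g_j ≥ 1∕T` and the penalty is `≥ ω(1∕T)`), forward `Σ_{[k,n)} ω(g_j) ≤ 1∕g⋆² + Σ_{[k,n)} b ≤ T²`.
[cite: Balaban1987RG1, (0.20) p.256] -/
theorem window_count_mod {ω : ℝ → ℝ} (hω : IsModulus ω) {M₀ : ℝ} (hM₀ : ∀ k n : ℕ, k ≤ n → -M₀ ≤ ∑ j ∈ Finset.Ico k n, b j)
    {Cn : B12.Construction} (hgen : ForwardGenerated Cn (betaMod b ω)) (P : B12.RunParams) {γ gstar : ℝ}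
    (hI : (Cn P).flow.InInterval γ P.K) (hend : (Cn P).flow.g P.K = gstar) {k : ℕ} (hk : k ≤ P.K) :
    0 < 1 / gstar ^ 2 + M₀ + ∑ i ∈ Finset.Ico k P.K, b i ∧
      (((P.K : ℕ) : ℝ) - k) * ω (1 / Real.sqrt (1 / gstar ^ 2 + M₀ + ∑ i ∈ Finset.Ico k P.K, b i)) ≤
        1 / gstar ^ 2 + M₀ + ∑ i ∈ Finset.Ico k P.K, b i := by
  have hM00 : 0 ≤ M₀ := by have h := hM₀ 0 0 le_rfl; simp at h; linarith
  have hgpos : ∀ j, j ≤ P.K → 0 < (Cn P).flow.g j := fun j hj => (hI j hj).1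
  have hgs : 0 < gstar := by rw [← hend]; exact hgpos _ le_rfl
  have hwin : ∀ j, j ≤ P.K → 1 / ((Cn P).flow.g j) ^ 2 - 1 / gstar ^ 2 ≤
      ∑ i ∈ Finset.Ico j P.K, b i - ∑ i ∈ Finset.Ico j P.K, ω ((Cn P).flow.g i) := by
    intro j hj
    have h := windowSum_ge_of_forwardGenerated hgen P hI hj le_rfl
    rw [hend] at h
    have hterm : ∀ i ∈ Finset.Ico j P.K, betaMod b ω i (prefixOf (Cn P).flow.g i) = b i - ω ((Cn P).flow.g i) :=
      fun i hi => by
        rw [betaMod_of_pos b ω i (by simpa using hgpos i (Finset.mem_Ico.mp hi).2.le)]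
        simp only [prefixOf_apply, Fin.val_last]
    rw [Finset.sum_congr rfl hterm, Finset.sum_sub_distrib] at h
    exact h
  set S : ℝ := ∑ i ∈ Finset.Ico k P.K, b i with hS
  have hpen_nonneg : ∀ j, 0 ≤ ∑ i ∈ Finset.Ico j P.K, ω ((Cn P).flow.g i) := fun j =>
    Finset.sum_nonneg fun i hi => (hω.pos _ (hgpos i (Finset.mem_Ico.mp hi).2.le)).le
  have hk0 : 0 < 1 / ((Cn P).flow.g k) ^ 2 := one_div_pos.mpr (pow_pos (hgpos k hk) 2)
  have hT2 : 0 < 1 / gstar ^ 2 + M₀ + S := by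
    have h := hwin k hk
    linarith [hpen_nonneg k]
  set T : ℝ := Real.sqrt (1 / gstar ^ 2 + M₀ + S) with hT
  have hT0 : 0 < T := Real.sqrt_pos.mpr hT2
  have hTsq : T ^ 2 = 1 / gstar ^ 2 + M₀ + S := Real.sq_sqrt hT2.le
  -- every coupling of the window is ≥ 1/T, so every penalty is ≥ ω(1/T)
  have hpen : ∀ j ∈ Finset.Ico k P.K, ω (1 / T) ≤ ω ((Cn P).flow.g j) := by
    intro j hj
    have hkj : k ≤ j := (Finset.mem_Ico.mp hj).1
    have hjn : j ≤ P.K := (Finset.mem_Ico.mp hj).2.le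
    have hgj := hgpos j hjn
    have hw := hwin j hjn
    have hsplit := Finset.sum_Ico_consecutive b hkj hjn
    have hpre := hM₀ k j hkj
    have hyj : 1 / ((Cn P).flow.g j) ^ 2 ≤ T ^ 2 := by rw [hTsq]; linarith [hpen_nonneg j]
    have hgT : 1 / T ≤ (Cn P).flow.g j := by
      have h1 : 1 / ((Cn P).flow.g j) ^ 2 ≤ 1 / (1 / T) ^ 2 := by rw [div_pow, one_pow, one_div_one_div]; exact hyj
      have h2 : (1 / T) ^ 2 ≤ ((Cn P).flow.g j) ^ 2 := (one_div_le_one_div (pow_pos hgj 2) (pow_pos (by positivity) 2)).mp h1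
      exact (pow_le_pow_iff_left₀ (by positivity) hgj.le two_ne_zero).mp h2
    exact hω.mono _ _ (by positivity) hgT
  have hcount : (((P.K : ℕ) : ℝ) - k) * ω (1 / T) ≤ ∑ i ∈ Finset.Ico k P.K, ω ((Cn P).flow.g i) := by
    have h := Finset.sum_le_sum hpen
    rw [Finset.sum_const, Nat.card_Ico, nsmul_eq_mul, Nat.cast_sub hk] at h
    exact h
  have hfwd : ∑ i ∈ Finset.Ico k P.K, ω ((Cn P).flow.g i) ≤ 1 / gstar ^ 2 + S := by
    have hw := hwin k hk
    linarith
  exact ⟨hT2, by linarith⟩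

/-- **WINDOW COUNTING FOR A MODULUS** · `DwSeq b 0` (bound `M₀`), `C₀ ≥ 0`, a modulus `ω`, and every window satisfying `0 < C₀ + Σ_{[k,n)} b` and
`(n − k)·ω(1∕√(C₀ + Σ_{[k,n)} b)) ≤ C₀ + Σ_{[k,n)} b` ⟹ `∃ r > 0, DwSeq b r`: a window of length `m₀ > (C₀ + 1)∕ω(1∕√(C₀+1))` with mass `< 1` is
impossible (monotonicity of `ω`), so `q` consecutive blocks carry mass `≥ q`, the remainder `≥ −M₀`, and `DwSeq b (1∕m₀)`. [folklore] -/
theorem dwSeq_pos_of_windowCount_mod {ω : ℝ → ℝ} (hω : IsModulus ω) {M₀ C₀ : ℝ}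
    (hM₀ : ∀ k n : ℕ, k ≤ n → -M₀ ≤ ∑ j ∈ Finset.Ico k n, b j) (hC₀ : 0 ≤ C₀)
    (h : ∀ k n : ℕ, k ≤ n → 0 < C₀ + ∑ j ∈ Finset.Ico k n, b j ∧
      ((n : ℝ) - k) * ω (1 / Real.sqrt (C₀ + ∑ j ∈ Finset.Ico k n, b j)) ≤ C₀ + ∑ j ∈ Finset.Ico k n, b j) :
    ∃ r : ℝ, 0 < r ∧ DwSeq b r := by
  have hM00 : 0 ≤ M₀ := by have h0 := hM₀ 0 0 le_rfl; simp at h0; linarith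
  set ω₁ : ℝ := ω (1 / Real.sqrt (C₀ + 1)) with hω₁
  have hω₁pos : 0 < ω₁ := hω.pos _ (by positivity)
  set m₀ : ℕ := ⌈(C₀ + 1) / ω₁⌉₊ + 1 with hm₀
  have hm₀pos : 0 < m₀ := Nat.succ_pos _
  have hm₀R : (C₀ + 1) / ω₁ < (m₀ : ℝ) := by
    rw [hm₀]; push_cast; exact (Nat.le_ceil _).trans_lt (lt_add_one _)
  have hm₀R' : C₀ + 1 < (m₀ : ℝ) * ω₁ := by
    have := (div_lt_iff₀ hω₁pos).mp hm₀R; linarith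
  -- every window of length m₀ carries mass ≥ 1
  have hblock : ∀ k : ℕ, 1 ≤ ∑ j ∈ Finset.Ico k (k + m₀), b j := by
    intro k
    refine le_of_not_gt fun hlt => ?_
    obtain ⟨hpos, hw⟩ := h k (k + m₀) (Nat.le_add_right _ _)
    have hL : ((k + m₀ : ℕ) : ℝ) - k = m₀ := by push_cast; ring
    rw [hL] at hw
    have hsq : Real.sqrt (C₀ + ∑ j ∈ Finset.Ico k (k + m₀), b j) ≤ Real.sqrt (C₀ + 1) := Real.sqrt_le_sqrt (by linarith)
    have hsqpos : 0 < Real.sqrt (C₀ + ∑ j ∈ Finset.Ico k (k + m₀), b j) := Real.sqrt_pos.mpr hpos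
    have hinv : 1 / Real.sqrt (C₀ + 1) ≤ 1 / Real.sqrt (C₀ + ∑ j ∈ Finset.Ico k (k + m₀), b j) := one_div_le_one_div_of_le hsqpos hsq
    have hωle : ω₁ ≤ ω (1 / Real.sqrt (C₀ + ∑ j ∈ Finset.Ico k (k + m₀), b j)) := hω.mono _ _ (by positivity) hinv
    have : (m₀ : ℝ) * ω₁ ≤ (m₀ : ℝ) * ω (1 / Real.sqrt (C₀ + ∑ j ∈ Finset.Ico k (k + m₀), b j)) :=
      mul_le_mul_of_nonneg_left hωle (by positivity)
    linarith
  -- q consecutive blocks carry mass ≥ q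
  have hblocks : ∀ q k : ℕ, (q : ℝ) ≤ ∑ j ∈ Finset.Ico k (k + q * m₀), b j := by
    intro q
    induction q with
    | zero => intro k; simp
    | succ q ih =>
      intro k
      have h2 : k + (q + 1) * m₀ = (k + q * m₀) + m₀ := by ring
      have hsplit := Finset.sum_Ico_consecutive b (Nat.le_add_right k (q * m₀))
        (by rw [h2]; exact Nat.le_add_right _ _ : k + q * m₀ ≤ k + (q + 1) * m₀)
      rw [← hsplit, h2]
      push_cast
      linarith [ih k, hblock (k + q * m₀)]
  refine ⟨1 / m₀, by positivity, M₀ + 1, fun k n hkn => ?_⟩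
  obtain ⟨L, rfl⟩ := Nat.exists_eq_add_of_le hkn
  have hLlt : L < (L / m₀ + 1) * m₀ := by
    have h3 : (L / m₀ + 1) * m₀ = m₀ * (L / m₀) + m₀ := by ring
    rw [h3]
    have hdm := Nat.div_add_mod L m₀
    have hml := Nat.mod_lt L hm₀pos
    omega
  have hqle : L / m₀ * m₀ ≤ L := Nat.div_mul_le_self L m₀
  have hsplit := Finset.sum_Ico_consecutive b (Nat.le_add_right k (L / m₀ * m₀)) (by omega : k + L / m₀ * m₀ ≤ k + L)
  have hrest := hM₀ (k + L / m₀ * m₀) (k + L) (by omega)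
  have hmain := hblocks (L / m₀) k
  rw [sum_Ico_sub_const b (1 / m₀) hkn]
  have hm₀R0 : (0 : ℝ) < m₀ := by exact_mod_cast hm₀pos
  have hLq : ((k + L : ℕ) : ℝ) - k = L := by push_cast; ring
  rw [hLq]
  have hLlt' : (L : ℝ) < ((L / m₀ : ℕ) + 1 : ℝ) * m₀ := by exact_mod_cast hLlt
  have hdiv : 1 / (m₀ : ℝ) * L ≤ (L / m₀ : ℕ) + 1 := by
    rw [one_div_mul_eq_div, div_le_iff₀ hm₀R0]
    exact hLlt'.le
  linarith

/-- **THE MODULUS ADVERSARY KILLS THE END WITHOUT A POSITIVE DRAWDOWN THRESHOLD** · `DwSeq b 0` and `EndpointExistence` of SOME forward-generated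
construction of `b − ω(g_k)` ⟹ `∃ r > 0, DwSeq b r`. [cite: Balaban1987RG1, (0.20) p.256 and Thm 2 p.259 (first sentence)] -/
theorem dwSeq_pos_of_endpointExistence_mod {ω : ℝ → ℝ} (hω : IsModulus ω) (h0 : DwSeq b 0) {Cn : B12.Construction}
    (hgen : ForwardGenerated Cn (betaMod b ω)) (hE : EndpointExistence Cn) : ∃ r : ℝ, 0 < r ∧ DwSeq b r := by
  obtain ⟨M₀, hM00, hM₀⟩ := h0.exists_nonneg
  have hM₀' : ∀ k n : ℕ, k ≤ n → -M₀ ≤ ∑ j ∈ Finset.Ico k n, b j := fun k n hkn => by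
    have h := hM₀ k n hkn; simpa using h
  obtain ⟨γ₂, hγ₂, hγ⟩ := hE 0
  obtain ⟨gstar, hgstar, hg⟩ := hγ γ₂ hγ₂ le_rfl
  have hrun := hg gstar hgstar le_rfl
  refine dwSeq_pos_of_windowCount_mod hω hM₀' (C₀ := 1 / gstar ^ 2 + M₀) (by positivity) fun k n hkn => ?_
  obtain ⟨g0, hI, hend⟩ := hrun n
  exact window_count_mod hω hM₀' hgen ⟨n, 0, g0⟩ hI hend hkn

/-! ## §3 FORCING IS MODULUS-FREE -/

/-- **THEOREM · `EndForcedMod b ω γ₀ ⟺ ∃ r > 0, DwSeq b r`** for every real sequence `b`, every modulus `ω`, every box `0 < γ₀`.  ⟸: the every-slope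
sufficiency restricted to the subclass; ⟹: the zero remainder (in the class) gives `DwSeq b 0`, the modulus adversary (in the class) gives the
counting inequality, whence a positive threshold. [cite: Balaban1987RG1, Thm 2 p.259 (first sentence) and (2.12)–(2.14) p.268] -/
theorem endForcedMod_iff_dwSeq_pos {ω : ℝ → ℝ} (hω : IsModulus ω) {γ₀ : ℝ} (hγ₀ : 0 < γ₀) :
    EndForcedMod b ω γ₀ ↔ ∃ r : ℝ, 0 < r ∧ DwSeq b r := by
  refine ⟨fun hF => ?_, fun ⟨_, hr, hDw⟩ => endForcedMod_of_endForcedES hω hγ₀ (endForcedES_of_dwSeq_pos hr hDw)⟩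
  have h0 : DwSeq b 0 := by
    have hE0 := hF _ (splitShift b 0) _ (fun _ => rfl) (fun k p hp => by
        show |(if 0 < p (Fin.last k) then (0 : ℝ) else 0)| ≤ ω (p (Fin.last k))
        rw [if_pos (hp (Fin.last k)).1, abs_zero]
        exact (hω.pos _ (hp (Fin.last k)).1).le)
      (betaContH_betaShift b 0 γ₀) (modelOf_forwardGenerated _)
    simpa using dwSeq_of_endpointExistence_betaShift (modelOf_forwardGenerated _) hE0
  have hE := hF _ (splitMod b ω) _ (fun _ => rfl) (mod_splitMod b hω γ₀) (betaContH_betaMod b hω γ₀) (modelOf_forwardGenerated _)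
  exact dwSeq_pos_of_endpointExistence_mod hω h0 (modelOf_forwardGenerated _) hE

/-- **FORCING: EVERY MODULUS ROAD = THE EVERY-SLOPE ROAD** (`0 < γ₀`): `EndForcedMod b ω γ₀ ⟺ EndForcedES b γ₀` — no remainder modulus lowers the
END-grade forcing threshold below the drawdown slope. [cite: Balaban1987RG1, Thm 3 p.264 and (2.12)–(2.14) p.268] -/
theorem endForcedMod_iff_endForcedES {ω : ℝ → ℝ} (hω : IsModulus ω) {γ₀ : ℝ} (hγ₀ : 0 < γ₀) : EndForcedMod b ω γ₀ ↔ EndForcedES b γ₀ := by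
  rw [endForcedMod_iff_dwSeq_pos hω hγ₀, endForcedES_iff_dwSeq_pos hγ₀]

/-- All modulus roads agree with one another for forcing (and with the linear road: `EndDrawdownLinearRoad.endForcedLin_iff_dwSeq_pos` is the case
`ω = C·x`). [folklore] -/
theorem endForcedMod_free {ω ω' : ℝ → ℝ} (hω : IsModulus ω) (hω' : IsModulus ω') {γ₀ γ₀' : ℝ} (hγ₀ : 0 < γ₀) (hγ₀' : 0 < γ₀') :
    EndForcedMod b ω γ₀ ↔ EndForcedMod b ω' γ₀' := by
  rw [endForcedMod_iff_dwSeq_pos hω hγ₀, endForcedMod_iff_dwSeq_pos hω' hγ₀']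

/-- The linear road is a modulus road: `EndForcedLin b C γ₀ ⟺ EndForcedMod b (C·) γ₀` (`C > 0`, `0 < γ₀`). [folklore] -/
theorem endForcedLin_iff_endForcedMod {C γ₀ : ℝ} (hC : 0 < C) (hγ₀ : 0 < γ₀) :
    EndDrawdownLinearRoad.EndForcedLin b C γ₀ ↔ EndForcedMod b (fun x => C * x) γ₀ := by
  rw [EndDrawdownLinearRoad.endForcedLin_iff_dwSeq_pos hC hγ₀, endForcedMod_iff_dwSeq_pos (isModulus_linear hC) hγ₀]

end

end Summit.QuantumFields.BalabanUV.Gaps.EndDrawdownModulusRoad
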